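import Summits.AtomisticToContinuum.FouriersLaw.Theorems.BondHeatUncertaintySubdiffusiveBondHeatKernelGibbsC
import Mathlib.Probability.Kernel.Composition.IntegralCompProd

/-!
# Kernel-level Gibbs invariance for the pinned chain, part D: invariance of the Gibbs measure

Last of four support files proving clause (a) of `BoundaryEscapeDeficit.BoundaryKernelBasics`
(stmt-AtomisticToContinuum-12239) for the pinned anharmonic chain, needed by crux `stmt-AtomisticToContinuum-9120`
(`BondHeatUncertainty.SubdiffusiveBondHeat`, line `bath-bond-deficit-integral`: stationarity of the kernel process
started from `μ_T` is what makes `V_N(0,t) = Var_eq(∫₀ᵗ j₀)` and de-junks `K_N`, `θ_N`, `E_N`). Lebesgue duality of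
the forward and reversed kernels `dx P_t(x,dy) = e^{2γt} dy P̂_t(y,dx)` (`LangevinChainReversal`) and the eigen-relation
of part C give `∫ e^{-H/T}(x) P_t(x,A) dx = ∫_A e^{-H/T}` for `t > 0`, hence
`(e^{-H/T}dx).bind P_t = e^{-H/T}dx`, `μ_T.bind P_t = μ_T`, and — through the kernel identification of part A —
**`(gibbsMeasure N T).bind (transitionKernel N T T t) = gibbsMeasure N T`** for `pinnedChain ω₂ lam β γ`
(`ω₂ > 0`, `lam, β, γ ≥ 0`, `N ≥ 1`, `T > 0`, every `t ≥ 0`), plus the integral form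
`∫ (P_t g) dμ_T = ∫ g dμ_T`.
-/

noncomputable section

open MeasureTheory ProbabilityTheory Filter Topology Set
open scoped NNReal ENNReal

namespace Summit.AtomisticToContinuum.FouriersLaw.Theorems.SubdiffusiveBondHeat

open Literature.MathematicalPhysics.KineticTheory.HeatConduction
open Literature.MathematicalPhysics.KineticTheory Literature.Probability.Process OscillatorChain

variable {N : ℕ}

/-! ### Invariance of the Gibbs measure under the transition kernels at equal bath temperatures -/

section Invariance

variable {P : OscillatorChain} (hP : P.IsConfining)
  (hU : ContDiff ℝ ((⊤ : ℕ∞) : WithTop ℕ∞) P.U) (hV : ContDiff ℝ ((⊤ : ℕ∞) : WithTop ℕ∞) P.V)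
  {N : ℕ} (hN : 0 < N) {T : ℝ} (hT : 0 < T)
include hP hU hV hN hT

/-- **The Gibbs density is invariant for the forward kernels** (set form): for `t > 0` and measurable `A`,
`∫ ρ(x) P_t(x, A) dx = ∫_A ρ`, `ρ = e^{-H/T}` — Lebesgue duality `dx P_t(x,dy) = e^{2γt} dy P̂_t(y,dx)`
(`LangevinChainReversal`) and the eigenfunction relation `P̂_t ρ = e^{-2γt} ρ`.
[cite: CuneoEckmannHairerReyBellet2018, §3.1] -/
theorem lintegral_gibbsDensity_mul_langevinKernel {t : ℝ≥0} (ht : 0 < t) {A : Set (PhaseSpace N)}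
    (hA : MeasurableSet A) :
    ∫⁻ x, ENNReal.ofReal (P.gibbsDensity N T x) * (P.langevinKernel N T T t x) A =
      ∫⁻ x in A, ENNReal.ofReal (P.gibbsDensity N T x) := by
  set ρ := P.gibbsDensity N T with hρdef
  have hρc : Continuous ρ := P.continuous_gibbsDensity hP.contDiff_U.continuous hP.contDiff_V.continuous N T
  have hρ0 : ∀ y, 0 ≤ ρ y := fun y => (P.gibbsDensity_pos N T y).le
  have hρm : Measurable fun x => ENNReal.ofReal (ρ x) := hρc.measurable.ennreal_ofReal
  haveI : ∀ y, IsProbabilityMeasure (P.langevinRevKernel N T T t y) := fun y =>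
    isProbabilityMeasure_langevinRevKernel hP N T T t y
  -- duality with `H(x, y) = ρ(x) 1_A(y)`
  have h1m : Measurable (A.indicator fun _ : PhaseSpace N => (1:ℝ≥0∞)) := measurable_const.indicator hA
  set Hf : PhaseSpace N × PhaseSpace N → ℝ≥0∞ :=
    fun p => ENNReal.ofReal (ρ p.1) * A.indicator (fun _ => (1:ℝ≥0∞)) p.2 with hHf
  have hHm : Measurable Hf := (hρm.comp measurable_fst).mul (h1m.comp measurable_snd)
  have hdual := hP.lintegral_langevinKernel_duality (T_L := T) (T_R := T) hU hV hN ht hHm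
  have hL : ∀ x, ∫⁻ y, Hf (x, y) ∂(P.langevinKernel N T T t x) =
      ENNReal.ofReal (ρ x) * (P.langevinKernel N T T t x) A := by
    intro x
    simp only [hHf]
    rw [lintegral_const_mul _ h1m, lintegral_indicator_const hA, one_mul]
  have hR : ∀ y, ∫⁻ x, Hf (x, y) ∂(P.langevinRevKernel N T T t y) =
      A.indicator (fun _ => (1:ℝ≥0∞)) y * ENNReal.ofReal (Real.exp (-(2 * P.γ) * t) * ρ y) := by
    intro y
    simp only [hHf]
    rw [lintegral_mul_const _ hρm, mul_comm]
    congr 1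
    have hint : Integrable ρ (P.langevinRevKernel N T T t y) :=
      (integrable_const 1).mono' hρc.aestronglyMeasurable (Eventually.of_forall fun x => by
        rw [Real.norm_of_nonneg (hρ0 x), hρdef, OscillatorChain.gibbsDensity, Real.exp_le_one_iff, neg_div]
        exact neg_nonpos.2 (div_nonneg (P.hamiltonian_nonneg_of_nonneg hP.U_nonneg hP.V_nonneg N x) hT.le))
    rw [← ofReal_integral_eq_lintegral_ofReal hint (Eventually.of_forall hρ0),
      integral_gibbsDensity_langevinRevKernel hP hU hV hN hT t y]
  simp_rw [hL, hR] at hdual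
  have hmeas : Measurable fun y => A.indicator (fun _ => (1:ℝ≥0∞)) y *
      ENNReal.ofReal (Real.exp (-(2 * P.γ) * t) * ρ y) :=
    h1m.mul ((measurable_const.mul hρc.measurable).ennreal_ofReal)
  rw [hdual, ← lintegral_indicator hA, ← lintegral_const_mul _ hmeas]
  refine lintegral_congr fun y => ?_
  by_cases hy : y ∈ A
  · simp only [hy, indicator_of_mem, one_mul]
    rw [ENNReal.ofReal_mul (Real.exp_pos _).le, ← mul_assoc, ← ENNReal.ofReal_mul (Real.exp_pos _).le,
      ← Real.exp_add]
    have : 2 * P.γ * (t:ℝ) + -(2 * P.γ) * t = 0 := by ring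
    rw [this, Real.exp_zero, ENNReal.ofReal_one, one_mul]
  · simp [hy]

/-- **Kernel invariance of the Gibbs weight** `e^{-H/T} dx` under the constructed transition kernels of a chain
with smooth confining potentials at equal bath temperatures (`N ≥ 1`, `T > 0`), measure form:
`(e^{-H/T}·dx) ∘ P_t = e^{-H/T}·dx` for every `t ≥ 0`. [cite: CuneoEckmannHairerReyBellet2018, §3.1] -/
theorem withDensity_gibbsDensity_bind_langevinKernel (t : ℝ≥0) :
    (volume.withDensity fun x => ENNReal.ofReal (P.gibbsDensity N T x)).bind (P.langevinKernel N T T t) =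
      volume.withDensity fun x => ENNReal.ofReal (P.gibbsDensity N T x) := by
  have hρc : Continuous (P.gibbsDensity N T) :=
    P.continuous_gibbsDensity hP.contDiff_U.continuous hP.contDiff_V.continuous N T
  have hρm : Measurable fun x => ENNReal.ofReal (P.gibbsDensity N T x) := hρc.measurable.ennreal_ofReal
  rcases eq_or_lt_of_le (show (0:ℝ≥0) ≤ t from bot_le) with ht | ht
  · rw [← ht, hP.langevinKernel_zero N T T]
    have : (⇑(Kernel.id : Kernel (PhaseSpace N) (PhaseSpace N))) = Measure.dirac := funext fun x => Kernel.id_apply x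
    rw [this, Measure.bind_dirac]
  · refine Measure.ext fun A hA => ?_
    rw [Measure.bind_apply hA (Kernel.measurable _).aemeasurable,
      lintegral_withDensity_eq_lintegral_mul₀ hρm.aemeasurable
        (Kernel.measurable_coe _ hA).aemeasurable,
      withDensity_apply _ hA]
    exact lintegral_gibbsDensity_mul_langevinKernel hP hU hV hN hT ht hA

/-- **Kernel invariance of the Gibbs measure** `μ_T = Z⁻¹ e^{-H/T} dx` (when `e^{-H/T}` is integrable) under
the constructed transition kernels at equal bath temperatures: `μ_T ∘ P_t = μ_T`, `t ≥ 0`.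
[cite: CuneoEckmannHairerReyBellet2018, §3.1] -/
theorem gibbsMeasure_bind_langevinKernel (hint : Integrable (P.gibbsDensity N T)) (t : ℝ≥0) :
    (P.gibbsMeasure N T).bind (P.langevinKernel N T T t) = P.gibbsMeasure N T := by
  rw [P.gibbsMeasure_eq_smul_withDensity hint]
  set c := (P.partitionFunction N T)⁻¹
  set ν := volume.withDensity fun x => ENNReal.ofReal (P.gibbsDensity N T x)
  have hsmul : (c • ν).bind (P.langevinKernel N T T t) = c • ν.bind (P.langevinKernel N T T t) := by
    refine Measure.ext fun A hA => ?_
    rw [Measure.bind_apply hA (Kernel.measurable _).aemeasurable, Measure.smul_apply,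
      Measure.bind_apply hA (Kernel.measurable _).aemeasurable, lintegral_smul_measure, smul_eq_mul]
  rw [hsmul, withDensity_gibbsDensity_bind_langevinKernel hP hU hV hN hT t]

end Invariance

/-! ### The pinned chain: Gibbs invariance of `OscillatorChain.transitionKernel` -/

section Pinned

variable {ω₂ lam β γ : ℝ} (hω : 0 < ω₂) (hl : 0 ≤ lam) (hβ : 0 ≤ β) (hγ : 0 ≤ γ) {N : ℕ} (hN : 0 < N)
  {T : ℝ} (hT : 0 < T)
include hω hl hβ hγ hN hT

/-- **BoundaryKernelBasics (a), proved**: for the pinned anharmonic chain (`ω₂ > 0`, `lam, β, γ ≥ 0`), every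
`N ≥ 1` and `T > 0`, the Gibbs measure `gibbsMeasure N T = Z⁻¹ e^{-H/T} dq dp` is invariant under the constructed
transition kernels `transitionKernel N T T t` (both baths at `T`), for every `t ≥ 0`:
`(gibbsMeasure N T).bind (transitionKernel N T T t) = gibbsMeasure N T`. This de-junks the equilibrium
autocorrelations `C_N(b,s)`, `K_N(u)` of routes `BondHeatUncertainty` / `BoundaryEscapeDeficit` (stationarity of
the kernel process started from `μ_T`). [cite: CuneoEckmannHairerReyBellet2018, §3.1] -/
theorem pinnedChain_gibbsMeasure_bind_transitionKernel (t : ℝ≥0) :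
    ((pinnedChain ω₂ lam β γ).gibbsMeasure N T).bind ((pinnedChain ω₂ lam β γ).transitionKernel N T T t) =
      (pinnedChain ω₂ lam β γ).gibbsMeasure N T := by
  rw [← pinnedChain_langevinKernel_eq_transitionKernel N T T hω hl hβ hγ t]
  exact gibbsMeasure_bind_langevinKernel (pinnedChain_isConfining hω hl hβ hγ) (pinnedChain_contDiff_U ω₂ lam β γ)
    (pinnedChain_contDiff_V ω₂ lam β γ) hN hT (pinnedChain_integrable_gibbsDensity hω hl hβ γ N hT) t

/-- Invariance in integral form: `∫ (∫ g dP_t(z,·)) dμ_T(z) = ∫ g dμ_T` for every `μ_T`-integrable `g`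
(`Measure.integral_comp`-style consequence of `pinnedChain_gibbsMeasure_bind_transitionKernel`). [folklore] -/
theorem pinnedChain_integral_transitionKernel_gibbsMeasure (t : ℝ≥0) {g : PhaseSpace N → ℝ}
    (hg : Integrable g ((pinnedChain ω₂ lam β γ).gibbsMeasure N T)) :
    ∫ z, (∫ y, g y ∂((pinnedChain ω₂ lam β γ).transitionKernel N T T t z))
        ∂((pinnedChain ω₂ lam β γ).gibbsMeasure N T) =
      ∫ y, g y ∂((pinnedChain ω₂ lam β γ).gibbsMeasure N T) := by
  have h := pinnedChain_gibbsMeasure_bind_transitionKernel hω hl hβ hγ hN hT t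
  set μT := (pinnedChain ω₂ lam β γ).gibbsMeasure N T
  set κ := (pinnedChain ω₂ lam β γ).transitionKernel N T T t
  have h' : (κ ∘ₖ Kernel.const Unit μT) () = μT := by
    rw [← Measure.comp_eq_comp_const_apply]; exact h
  have hg' : Integrable g ((κ ∘ₖ Kernel.const Unit μT) ()) := by rw [h']; exact hg
  have := ProbabilityTheory.Kernel.integral_comp hg'
  rw [h', Kernel.const_apply] at this
  exact this.symm

end Pinned

end Summit.AtomisticToContinuum.FouriersLaw.Theorems.SubdiffusiveBondHeat

end
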